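import Summits.ABC.IUTFork.Repair.ScalarShellsThm311
import Summits.ABC.IUTFork.Cor312PinnedRegionsThreePins
import HarnessLib

/-!
# IUT REPAIR BRANCH (LADDER-ABC:A2.RP), class (iii) JOSHI, j2 — the SCALING-SHELLS MODEL for door (a): a typed [IUTchIII] Thm. 3.11
# instance over abc-iut-w4-d098's scaling shells with the EMPTY region admissible at the junk label, a scale-EQUIVARIANT pinned setting
# with HONEST glue, the three pins, honest volumes (built BY NAME on `Repair.ScalarShells` / `Repair.ScalarShellsThm311`)

Record file of the abc-iut cell's IUT REPAIR BRANCH (seat abc-iut-rp-j2; rows RP-J05 / RP-J03 door (a); sequel to `Repair/CandJoshi21`,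
p427435). TAKES NO SIDE on [IUTchIII] Cor. 3.12 or on any author. MODEL DATA only (toy, over abc-iut-c312-7's one-place index
`toyIndex`, `l⋇ = 2`); no `Prop` fact; nothing about the intended objects of [IUTchIII] or of K. Joshi's theory is asserted. PURPOSE: the
protocol's (T-c) for the door-(a) candidates H_J21-2 `JoshiScalingIndeterminacy` / H_J21-5 `JoshiNonIsometricIndeterminacy` («the
indeterminacy group contains the Θ_gau-link's valuation scaling»: arXiv:2106.11452 Thm. (th:main3); arXiv:2303.01662 Thm. 6.9.1 (3)(4),
Rmk. 6.10.4, §8.2.1, Rmk. 8.5.2), recorded OPEN on the families of record (w4-d098 `CandJoshi21Models`).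

WHY A SECOND SITUATION OVER THE SAME SHELLS. abc-iut-w4-d098's `Repair.ScalarShells` (p429955: `scalingShells p` = the one-place `ℚ`-shells
with stripAut = Ism = ALL of `ℚˣ`; the closure lemma `actsByScalars_of_mem_closure`; ball transport `image_sBall_of_line_eq`) and
`Repair.ScalarShellsThm311` (p430579: `sFull p`, `sFull_statement`, the move `sFamDep (cQ p)` with `starAut_cQ_Psi : Ψ_v ↦ qDatum`) are
used BY NAME and NOT restated. What they do not contain is a PINNED SETTING with an (hρ)-equivariant region reading: over `sData` (Adm :=
balls only) none exists — (hρ) for a scaling group forces the reading at the junk label `0` to be scale-INVARIANT (`ρ X 0 = Φ 0 '' ρ X 0`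
for a scaling `Φ` trivial on the star packets), no ball is; the q-pin then makes the label-`0` q-glue that invariant set, `qRegion_mem`
puts it in the frame's hull-sets and `hul_adm` in `Adm` — so the situation's admissible regions must contain a scale-invariant hull-set
at label `0`. Hence this file's `scaleData` := w4-d098's `sData` with `Adm' := balls ∨ (j = 0 ∧ ∅)` (the empty region admissible AT
THE JUNK LABEL ONLY — label `0 ∉ 𝔽_l^⋇` carries no pilot component and is read by nothing in Cor. 3.12; cf. the zero-label convention of
`Cor312PinnedOperators` §0), the column `scaleColumn` (KummerA holds for `∅` too: the sign twist fixes it) and `scaleFull p`; RESULT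
`scaleFull_statement`: **the typed Thm. 3.11 (i) ∧ (ii) ∧ (iii) HOLDS** (as for `sFull`), `scale_kummerB`. Then (§5–§7): the setting
`scaleSetting p` = abc-iut-w4-d101's pinned setting (honest object side `pinSig`, pilots of exponent `1`) with HONEST glue on `𝔽_l^⋇` —
Θ-pilot ↦ `B_{j²} = q^{j²}𝒪`, q-pilot ↦ `B_1 = q𝒪` — and `∅` at the junk label (frame `scaleFrame` = w5-d247's ball frame + `∅ ∈ Hul` at
label `0`); the region reading `scaleRho` := w4-d101's `orbitRegion Ψ ↦ Ψ_j·𝒪` off the junk label, `∅` on it, EQUIVARIANT under the whole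
scalar group (`scaleRho_equivariant`, from w4-d098's closure lemma); **the THREE PINS for `(scaleRho, qDatum)`** with w4-d101's honest
q-pilot Kummer datum (`scale_pinnedRegions3`); HONEST VOLUMES: label-independent q-volume `−log p` (`scale_qLocal`), `|log(q)| > 0`
(`scale_absLogQPos`), honest `j²`-scaling in every packet of `𝔽_l^⋇` (`scale_hscaled`) — every clause of abc-iut-w4-d103's ∀-form except
Step (x) log-volume invariance, which the scaling shells deny by construction (w4-d098 `logvol_not_invariant`). The tests (H_J21-2 with a
non-trivial move, H_J21-5, the residual, the price `−|log(Θ)| = +∞`) are the sequel `CandJoshi22Tests`.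
HONEST SCOPE: interface-level; NOT a model of initial Θ-data; whether [IUTchIII]'s (Ind1)/(Ind2) contain non-isometric moves is what
print denies (Step (x), p. 181 l. 5–13) and Joshi's reading asserts — the model prices the reading, it does not read [IUTchIII].
[claim: Mochizuki2012, status: disputed] [claim: Joshi2023ATS2Local, status: disputed]
-/

noncomputable section

open Set

namespace Summit.ABC.IUTFork.Repair.CandJoshi22

open Thm311 Cor312 Cor312.Checks Cor312.IdentifiedNonVacuity Cor312Vol Cor312Vol.NaiveWitness Cor312Vol.PinnedWitness
  Literature.IUT.LogThetaLattice Summit.ABC.IUTFork.Repair Summit.ABC.IUTFork.Repair.ScalarShells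
  Summit.ABC.IUTFork.Repair.ScalarShellsThm311

variable (p : ℕ)

/-! ## 1. The data (a)(b)(c), the column and the full situation with `∅` admissible at the junk label -/

/-- Admissible regions of the scaling model: the balls — and, at the junk label `0` ONLY, the empty region (the unique scale-invariant
hull-set, needed there because (Ind1),(Ind2) now rescale the label-`0` packet too; the label is read by nothing in Cor. 3.12). [folklore] -/
def Adm' (j : toyIndex.Label) (vQ : toyIndex.VQ) (A : Set ((scalingShells p).Packet j vQ)) : Prop :=
  (∃ k, A = pBall p j vQ k) ∨ (j = 0 ∧ A = ∅)

/-- **The data (a)(b)(c) of the scaling model** — abc-iut-w4-d098's `sData` (= w5-d247's `naiveData` over the scaling shells) verbatim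
but for `Adm'`. [claim: Mochizuki2012, status: disputed] -/
def scaleData : MRData (scalingShells p) where
  shellPk := fun j vQ => pBall p j vQ 0
  shellSub := fun j v => pBall p j (toyIndex.over v) 0
  Adm := Adm' p
  logvol := fun j vQ A => pVol p j vQ A
  Ψ := fun v _ => Psi p v
  act := fun v _ y => LinearMap.pi fun j => (line j.1 (toyIndex.over v) (y j)) • LinearMap.proj j
  Mmod := fun _ => Set.univ

/-- The situation: scaling shells, `scaleData` on every vertical line, w4-d098's degrees `sDegrees`. [claim: Mochizuki2012, status: disputed] -/
abbrev scaleSituation : Situation toyIndex where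
  L := scalingShells p
  D := fun _ => scaleData p
  G := fun _ j => sDegrees p j

/-- **The column** — w5-d247's sign-twisted Kummer transport (as in w4-d098's `sColumn`), holomorphic admissibility read through `Adm'`.
[claim: Mochizuki2012, status: disputed] -/
def scaleColumn : Column (scalingShells p) where
  frobAdm := fun m j vQ A => Adm' p j vQ ((twist m : (scalingShells p).PacketAut) j vQ '' A)
  frobLogvol := fun m j vQ A => pVol p j vQ ((twist m : (scalingShells p).PacketAut) j vQ '' A)
  frobΨ := fun m v _ => (scalingShells p).starAut (twist m) v '' Psi p v
  frobMmod := fun m j => (scalingShells p).globalAut (twist m) j.1 '' Set.univ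
  unitImage := fun _ m' j vQ => pBall p j vQ ((m' : ℤ) + 1)
  ballImage := fun _ j vQ => pBall p j vQ 0
  ObjLGP := ℤ
  frobObjLGP := FrobObj
  kumLGP := kum
  ObjLgp := ℤ
  frobObjLgp := FrobObj
  kumLgp := kum
  thetaPilot := fun m => ⟨(1, m), rfl⟩

/-- **The full situation of the scaling model** (link data: w5-d247's `naiveLink`). [claim: Mochizuki2012, status: disputed] -/
abbrev scaleFull : FullSituation toyIndex where
  toSituation := scaleSituation p
  col := fun _ => scaleColumn p
  link := naiveLink

/-- The sign twist maps `Adm'`-regions to themselves (it fixes balls — w4-d098's `image_sBall_twist` — and `∅`). [folklore] -/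
theorem image_twist_of_adm' (m : ℤ) {j : toyIndex.Label} {vQ : toyIndex.VQ} {A : Set ((scalingShells p).Packet j vQ)}
    (hA : Adm' p j vQ A) : (twist m : (scalingShells p).PacketAut) j vQ '' A = A := by
  rcases hA with ⟨k, rfl⟩ | ⟨-, rfl⟩
  · exact image_sBall_twist p m j vQ k
  · exact Set.image_empty _

/-- **The typed Theorem 3.11 (i) ∧ (ii) ∧ (iii) HOLDS in the scaling model** (as w4-d098's `sFull_statement`; the only new case is `∅` at
the junk label in KummerA, fixed by the twist). [folklore] -/
theorem scaleFull_statement [Fact p.Prime] : (scaleFull p).Statement := by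
  have hI : (scaleFull p).PartI := by
    refine ⟨fun n v hv x _ j => ?_, fun n j k => ⟨fun vQ => Or.inl ⟨k, rfl⟩, Set.toFinite _, ?_⟩, fun _ _ => rfl⟩
    · show x j ∈ signShells.SubPacket j.1 v
      rw [subPacket_eq_top]; trivial
    · rw [finsum_unique]
      exact (pVol_pBall p j.1 _ k).symm
  refine ⟨hI, fun n => ?_, ?_⟩
  · refine (Column.partII_iff _ _).2 ⟨?_, fun m v hv => image_Psi_of_actsBySigns p (twist_actsBySigns m) v,
      fun m j => Set.image_univ_of_surjective ((scalingShells p).globalAut (twist m) j.1).surjective, ?_⟩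
    · intro m j vQ A hA
      have h := image_twist_of_adm' p m hA
      refine ⟨?_, ?_⟩
      · show Adm' p j vQ ((twist m : (scalingShells p).PacketAut) j vQ '' A)
        exact (congrArg (Adm' p j vQ) h).mpr hA
      · show pVol p j vQ ((twist m : (scalingShells p).PacketAut) j vQ '' A) = pVol p j vQ A
        exact congrArg (pVol p j vQ) h
    · exact ⟨fun m m' j vQ _ => pBall_mono p j vQ (by omega), fun m j vQ h => absurd trivial h⟩
  · refine ⟨naiveLink.partIIIa_holds, naiveLink.partIIIb_holds, ?_, ?_,
      (scaleFull p).evalCompatUpToInd_of_multiradialCompat hI.2.2⟩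
    · refine naiveLink.partIIIc_of_full (fun _ => rfl) fun n m => ?_
      rintro _ ⟨a, rfl⟩
      show unitIso a ≪≫ unitIso ((-1) ^ m.natAbs) = unitIso ((-1) ^ m.natAbs) ≪≫ unitIso a
      rw [unitIso_trans, unitIso_trans, mul_comm]
    · intro n m; exact Thm311.PolyIsoCalc.stabilized_full _ _

/-- Thm. 3.11 (ii) (b) for every column of the scaling model. [folklore] -/
theorem scale_kummerB [Fact p.Prime] (n : ℤ) : ((scaleFull p).col n).KummerB ((scaleFull p).D n) :=
  ((scaleFull_statement p).2.1 n).2.1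

variable [hp : Fact p.Prime]

/-! ## 5. The setting: honest glue, empty junk label -/

/-- The hull frame of the scaling model: w5-d247's `p`-adic ball frame, with `∅` an extra hull-set AT THE JUNK LABEL `0` only.
[claim: Mochizuki2012, status: disputed] -/
def scaleFrame (j : toyIndex.Label) (vQ : toyIndex.VQ) : HullFrame ((scalingShells p).Packet j vQ) where
  Hul := {H | (∃ k, H = pBall p j vQ k) ∨ (j = 0 ∧ H = ∅)}
  IsBounded := fun U => ∃ k, U ⊆ pBall p j vQ k
  HasHull := fun U =>
    ∃ k, U ⊆ pBall p j vQ k ∧ ∃ x ∈ U, line j vQ x ≠ 0 ∧ padicValRat p (line j vQ x) = k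
  hul_bounded := by
    rintro _ (⟨k, rfl⟩ | ⟨-, rfl⟩)
    · exact ⟨k, subset_rfl⟩
    · exact ⟨0, Set.empty_subset _⟩
  bounded_mono := fun U U' hUU' ⟨k, hk⟩ => ⟨k, hUU'.trans hk⟩
  exists_hul := fun U ⟨k, hk⟩ => ⟨pBall p j vQ k, Or.inl ⟨k, rfl⟩, hk⟩
  hull_mem := by
    rintro U - ⟨k, hUk, x, hxU, hx0, hxk⟩
    refine Or.inl ⟨k, ?_⟩
    apply Set.Subset.antisymm
    · exact Set.sInter_subset_of_mem ⟨Or.inl ⟨k, rfl⟩, hUk⟩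
    · refine Set.subset_sInter ?_
      rintro H ⟨(⟨k', rfl⟩ | ⟨-, rfl⟩), hUH⟩
      · refine pBall_mono p j vQ ?_
        rcases hUH hxU with h | h
        · exact absurd h hx0
        · rwa [hxk] at h
      · exact absurd (hUH hxU) (Set.notMem_empty _)

/-- **The setting of the scaling model**: abc-iut-w4-d101's pinned setting (honest object side `pinSig`, pilots of exponent `1`) over the
scaling situation, with HONEST glue on `𝔽_l^⋇` — the `(n,m)`-Kummer image of the lgp-object of exponent `k` at label `j ≠ 0` is `B_{k·j²}`,
the image of the `△`-object of exponent `k` is `B_k` — and the EMPTY region at the junk label `0`. [claim: Mochizuki2012, status: disputed] -/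
def scaleSetting : Setting (scaleSituation p) where
  n := 0
  HT := ℤ × ℤ
  LogLink := fun _ _ => Unit
  IsFull := fun _ => True
  lattice :=
    { theater := fun n m => (n, m)
      distinct := fun p q h => by simpa using h
      logLink := fun _ _ => ()
      logLink_full := fun _ _ => trivial }
  Frd := Unit
  IsoF := fun _ _ => Unit
  Ob := fun _ => ℤ
  realify := id
  Strip := Unit
  IsoS := fun _ _ => Unit
  M := fun _ _ => ExpMonoid
  sig := pinSig
  split := { Msplit := fun _ _ => ⊤, exists_gen := fun _ _ => ⟨⟨gen, trivial⟩, top_gen_isGenerator⟩ }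
  ObΔ := ℤ
  N := fun _ _ => ExpMonoid
  qData :=
    { q := fun _ _ => gen
      q_gen := fun _ _ => gen_isGenerator
      objOf := fun x => (expOf (x () (Set.mem_univ ())) : ℤ) }
  frame := fun j vQ => scaleFrame p j vQ
  hul_adm := fun _ _ _ hH => hH
  thetaRegionOf := fun _ k j vQ => if j = 0 then ∅ else pBall p j vQ (k * jsq j)
  qRegionOf := fun k j vQ => if j = 0 then ∅ else pBall p j vQ k
  qRegion_mem := fun j _ => by
    by_cases h : j = 0
    · exact Or.inr ⟨h, by rw [if_pos h]⟩
    · exact Or.inl ⟨_, by rw [if_neg h]⟩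
  qSupport_finite := fun _ => Set.toFinite _

omit hp in
/-- The Θ-pilot object is the lgp-object of exponent `1` (any generator up to torsion has exponent `1`). [folklore] -/
theorem scaleSetting_thetaPilot : (scaleSetting p).thetaPilot = (1 : ℤ) :=
  congrArg (Nat.cast : ℕ → ℤ)
    (expOf_eq_one_of_isGenerator_top (Classical.choose_spec ((scaleSetting p).split.exists_gen () (Set.mem_univ ()))))

omit hp in
/-- The q-pilot object is the `△`-object of exponent `1`. [folklore] -/
theorem scaleSetting_qPilot : (scaleSetting p).qPilot = (1 : ℤ) := rfl

omit hp in
/-- The `(n,m)`-Kummer image of the Θ-pilot at label `j`: `∅` at the junk label, the honest `B_{j²}` elsewhere. [folklore] -/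
theorem scaleSetting_thetaRegion (m : ℤ) (j : toyIndex.Label) (vQ : toyIndex.VQ) :
    (scaleSetting p).thetaRegion m j vQ = if j = 0 then ∅ else pBall p j vQ (jsq j) := by
  unfold Setting.thetaRegion
  rw [scaleSetting_thetaPilot]
  show (if j = 0 then ∅ else pBall p j vQ ((1 : ℤ) * jsq j)) = _
  rw [one_mul]

omit hp in
/-- The q-pilot image at label `j`: `∅` at the junk label, the honest `B_1 = q·𝒪` elsewhere. [folklore] -/
theorem scaleSetting_qRegion (j : toyIndex.Label) (vQ : toyIndex.VQ) :
    (scaleSetting p).qRegion j vQ = if j = 0 then ∅ else pBall p j vQ 1 := rfl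

omit hp in
/-- The (Ind3)-enlarged region at a nonzero label is `B_{j²}`. [folklore] -/
theorem scaleSetting_thetaRegion3 {j : toyIndex.Label} (hj : j ≠ 0) (vQ : toyIndex.VQ) :
    (scaleSetting p).thetaRegion3 j vQ = pBall p j vQ (jsq j) := by
  show (⋃ m : ℤ, (scaleSetting p).thetaRegion m j vQ) = _
  simp_rw [scaleSetting_thetaRegion, if_neg hj]
  exact Set.iUnion_const _

/-! ## 6. The region reading and the pins -/

omit hp in
/-- **The region reading of the scaling model**: w4-d101's monoid-to-region operator `Ψ ↦ Ψ_j·𝒪` at the labels of `𝔽_l^⋇`, the EMPTY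
region at the junk label (scale-invariant, as (hρ) now demands there). [claim: Mochizuki2012, status: disputed] -/
def scaleRho (X : ∀ v : toyIndex.V, v ∈ toyIndex.Vbad → Set ((scalingShells p).StarPacket v)) (j : toyIndex.Label)
    (vQ : toyIndex.VQ) : Set ((scalingShells p).Packet j vQ) :=
  if j = 0 then ∅ else orbitRegion p X j vQ

omit hp in
/-- **Equivariance of `orbitRegion` under a SCALAR move at a nonzero label** (w4-d101's `orbitRegion_equivariant` had signs; the same
algebra with any `c ≠ 0`). [folklore] -/
theorem orbitRegion_equivariant_of_scalar {Φ : (scalingShells p).PacketAut} (hΦ : ScalarShells.ActsByScalars p ⊤ Φ)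
    (X : ∀ v : toyIndex.V, v ∈ toyIndex.Vbad → Set ((scalingShells p).StarPacket v)) {j : toyIndex.Label} (hj : j ≠ 0)
    (vQ : toyIndex.VQ) :
    orbitRegion p (fun v hv => (scalingShells p).starAut Φ v '' X v hv) j vQ = Φ j vQ '' orbitRegion p X j vQ := by
  obtain ⟨u, -, hΦc⟩ := hΦ.scalar j vQ
  have hc : ((u : ℚˣ) : ℚ) ≠ 0 := u.ne_zero
  unfold orbitRegion
  rw [dif_neg hj, dif_neg hj]
  have h2 : ∀ ψ : (scalingShells p).StarPacket vQ,
      line j vQ ((scalingShells p).starAut Φ vQ ψ ⟨j, hj⟩) = (u : ℚ) * line j vQ (ψ ⟨j, hj⟩) := fun ψ => hΦc _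
  ext x
  constructor
  · rintro ⟨_, ⟨ψ, hψ, rfl⟩, w, hw, hx⟩
    refine ⟨(Φ j vQ).symm x, ⟨ψ, hψ, w, hw, ?_⟩, LinearEquiv.apply_symm_apply _ _⟩
    have h1 := hΦc ((Φ j vQ).symm x)
    rw [LinearEquiv.apply_symm_apply] at h1
    rw [h2] at hx
    have h3 : (u : ℚ) * line j vQ ((Φ j vQ).symm x) = (u : ℚ) * (line j vQ (ψ ⟨j, hj⟩) * line j vQ w) := by
      rw [← h1, hx, mul_assoc]
    exact mul_left_cancel₀ hc h3
  · rintro ⟨y, ⟨ψ, hψ, w, hw, hy⟩, rfl⟩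
    refine ⟨(scalingShells p).starAut Φ vQ ψ, ⟨ψ, hψ, rfl⟩, w, hw, ?_⟩
    rw [hΦc, h2, hy, mul_assoc]

omit hp in
/-- **(hρ): `scaleRho` is equivariant under the WHOLE group `⟨(Ind1) ∪ (Ind2)⟩` of the scaling shells** (scalars at `j ≠ 0`; `∅ ↦ ∅` at
the junk label). [folklore] -/
theorem scaleRho_equivariant {Φ : (scalingShells p).PacketAut}
    (hΦ : Φ ∈ Subgroup.closure ((scalingShells p).Ind1Family ∪ (scalingShells p).Ind2Family))
    (X : ∀ v : toyIndex.V, v ∈ toyIndex.Vbad → Set ((scalingShells p).StarPacket v)) (j : toyIndex.Label) (vQ : toyIndex.VQ) :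
    scaleRho p (fun v hv => (scalingShells p).starAut Φ v '' X v hv) j vQ = Φ j vQ '' scaleRho p X j vQ := by
  unfold scaleRho
  split_ifs with h
  · exact (Set.image_empty _).symm
  · exact orbitRegion_equivariant_of_scalar p (ScalarShells.actsByScalars_of_mem_closure hΦ) X h vQ

/-- `scaleRho` on the Θ-monoid datum: `B_{j²}` off the junk label. [folklore] -/
theorem scaleRho_Psi {j : toyIndex.Label} (hj : j ≠ 0) (vQ : toyIndex.VQ) :
    scaleRho p (fun v _ => Psi p v) j vQ = pBall p j vQ (jsq j) := by
  unfold scaleRho; rw [if_neg hj]; exact orbitRegion_Psi p j vQ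

/-- `scaleRho` on w4-d101's honest q-pilot Kummer datum `{(±q)_j}`: `B_1` off the junk label. [folklore] -/
theorem scaleRho_qDatum {j : toyIndex.Label} (hj : j ≠ 0) (vQ : toyIndex.VQ) :
    scaleRho p (qDatum p) j vQ = pBall p j vQ 1 := by
  unfold scaleRho; rw [if_neg hj]; exact orbitRegion_qDatum p hj vQ

/-- **(hρ) ∧ (pΘ) — the Θ-pilot pin HOLDS** in the scaling model. [claim: Mochizuki2012, status: disputed] -/
theorem scale_thetaPinned : ThetaPinned (scaleFull p).toLatticeSituation (scaleSetting p) (scaleRho p) := by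
  refine ⟨fun Φ hΦ X j vQ => scaleRho_equivariant p hΦ X j vQ, fun m j vQ => ?_⟩
  have hΨ : ((scaleFull p).col (scaleSetting p).n).frobΨ m = fun v _ => Psi p v := by
    funext v hv
    exact image_Psi_of_actsBySigns p (twist_actsBySigns m) v
  rw [hΨ, scaleSetting_thetaRegion]
  by_cases hj : j = 0
  · rw [if_pos hj]; unfold scaleRho; rw [if_pos hj]; rfl
  · rw [if_neg hj, scaleRho_Psi p hj]

/-- **(pq′) — the q-pilot pin HOLDS** for w4-d101's honest Kummer datum `qDatum`. [claim: Mochizuki2012, status: disputed] -/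
theorem scale_qPinned : QPinned (scaleFull p).toLatticeSituation (scaleSetting p) (scaleRho p) (qDatum p) := fun j vQ => by
  rw [scaleSetting_qRegion]
  by_cases hj : j = 0
  · rw [if_pos hj]; unfold scaleRho; rw [if_pos hj]; rfl
  · rw [if_neg hj, scaleRho_qDatum p hj]

omit hp in
/-- **(pL) — the link pin HOLDS** (identity of exponents, pilots of exponent `1`). [folklore] -/
theorem scale_linkPinned : LinkPinned (scaleFull p).toLatticeSituation (scaleSetting p) :=
  ⟨Equiv.refl ℤ, by rw [scaleSetting_thetaPilot, scaleSetting_qPilot]; rfl⟩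

/-- **`PinnedRegions3` HOLDS in the scaling model.** [claim: Mochizuki2012, status: disputed] -/
theorem scale_pinnedRegions3 : PinnedRegions3 (scaleFull p).toLatticeSituation (scaleSetting p) (scaleRho p) (qDatum p) :=
  ⟨⟨scale_thetaPinned p, scale_qPinned p⟩, scale_linkPinned p⟩

/-! ## 7. Honest volumes -/

/-- The local q-term at every label of `𝔽_l^⋇` is `μ(B_1) = −log p` (label-INDEPENDENT). [folklore] -/
theorem scale_qLocal (i : Fin toyIndex.lstar) (vQ : toyIndex.VQ) :
    (scaleSetting p).qLocal (Setting.labelSucc i) vQ = -Real.log p := by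
  show pVol p _ vQ ((scaleSetting p).qRegion (Setting.labelSucc i) vQ) = _
  rw [scaleSetting_qRegion, if_neg (Setting.labelSucc_ne_zero i), pVol_pBall]
  push_cast; ring

/-- `−|log(q)| = −log p`. [folklore] -/
theorem scale_negLogQ : (scaleSetting p).negLogQ = -Real.log p := by
  unfold Setting.negLogQ
  have h : (fun i : Fin toyIndex.lstar => ∑ᶠ vQ : toyIndex.VQ, (scaleSetting p).qLocal (Setting.labelSucc i) vQ) =
      fun _ => -Real.log p := by
    funext i; rw [finsum_unique]; exact scale_qLocal p _ _
  rw [h]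
  exact processionNormalized_const (by decide) _

/-- **`|log(q)| > 0`.** [folklore] -/
theorem scale_absLogQPos : (scaleSetting p).AbsLogQPos := by
  show (scaleSetting p).negLogQ < 0
  rw [scale_negLogQ, neg_lt_zero]
  exact log_p_pos p

/-- **HONEST `j²`-SCALING in every packet of `𝔽_l^⋇`**: `μ(ρ Ψ_n at label j) = μ(B_{j²}) = j²·μ(B_1) = j²·qLocal`. [folklore] -/
theorem scale_hscaled (i : Fin toyIndex.lstar) (vQ : toyIndex.VQ) :
    ((scaleFull p).D (scaleSetting p).n).logvol _ vQ (scaleRho p ((scaleFull p).D (scaleSetting p).n).Ψ (Setting.labelSucc i) vQ) =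
      (((i : ℕ) + 1 : ℕ) : ℝ) ^ 2 * (scaleSetting p).qLocal (Setting.labelSucc i) vQ := by
  have hΨ : ((scaleFull p).D (scaleSetting p).n).Ψ = fun v _ => Psi p v := rfl
  rw [hΨ, scaleRho_Psi p (Setting.labelSucc_ne_zero i), scale_qLocal]
  show pVol p _ vQ (pBall p _ vQ (jsq (Setting.labelSucc i))) = _
  rw [pVol_pBall]
  have hj : ((jsq (Setting.labelSucc i) : ℤ) : ℝ) = (((i : ℕ) + 1 : ℕ) : ℝ) ^ 2 := by
    unfold jsq
    rw [show ((Setting.labelSucc i : toyIndex.Label) : ℕ) = (i : ℕ) + 1 from Fin.val_succ i]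
    push_cast; ring
  rw [hj]; ring

end Summit.ABC.IUTFork.Repair.CandJoshi22

end
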